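import Literature.MathematicalPhysics.QuantumLattice.FermionLiebRobinson
import Literature.MathematicalPhysics.QuantumLattice.SpinSectorPartitionFnTransfer
import Literature.MathematicalPhysics.QuantumLattice.SpinTwistedHubbardTorus
import HarnessLib

/-!
# High-temperature current clustering for TcThermcert1's Hypothesis C — part 1: time reversal and regional particle numbers

Helper file for route `TcThermcert1` (crux K1′ `ThermalStiffnessCeilingU8b8_le_7o44`, item `stmt-Ventures-24560`; line
`Cruxes/ThermalStiffnessCeilingU8b8_le_7o44/Lines/gauge_qbp_far_seam.lean`, small-`β` rung `stub_currentClustering8_smallBeta` of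
Hypothesis C = `CurrentClustering U n β ξ`). The rung is proved (parts 1–5) by a canonical-ensemble high-temperature POLYMER expansion
of `e^{−βH}` in the local terms `hubbardTermOp G t U μ Z` (Möbius weights over sets of terms) combined with TIME REVERSAL: every
polymer configuration whose cluster attached to the bond `{a, b}` misses the support of the test observable contributes EXACTLY zero,
because in the occupation basis every partial Boltzmann factor is a real SYMMETRIC matrix conserving the particle numbers of its
region while the bond current is `i ×` a real ANTISYMMETRIC one. This part records the finite-dimensional algebra behind that step:

* §1 `tr(J M) = 0` for `Jᵀ = −J`, `Mᵀ = M`; the local Hubbard terms, their partial sums and the exponentials of those are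
  transpose-symmetric; the plain bond current `Σ_σ (−i c†_{aσ}c_{bσ} + i c†_{bσ}c_{aσ})` is transpose-antisymmetric.
* §2 diagonal matrices whose entries only depend on the occupations inside a set of orbitals `T` lie in `carEvenSubalgebra T`.
* §3 regional particle numbers: an even local operator of the sites `S` that conserves `(N↑, N↓)` conserves `(N↑_S, N↓_S)`
  entrywise, hence commutes with every diagonal function of `(N↑_S, N↓_S)` (the regional sector projections).

[cite: Ueltschi1999, §2.3 (polymer weights of quantum lattice systems at high temperature)] Finite-dimensional linear algebra; no
physics claim — K1′/K1 stay conditional ceilings, nothing here is a `T_c` estimate and superconductivity in the Hubbard model is NOT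
proved by anything in this file. No definitions; no `sorry`.
-/

noncomputable section

namespace Summit.Ventures.CertifiedManyBodySolver.Theorems.TcThermcert1.HighTempCurrentClustering

open Matrix Finset
open Literature.MathematicalPhysics.QuantumLattice
open scoped Matrix.Norms.L2Operator

/-! ## §1 Transpose symmetry: terms, partial Boltzmann factors, and the antisymmetric current -/

section Transpose

variable {n : Type*} [Fintype n]

/-- `tr(J M) = 0` when `J` is antisymmetric and `M` symmetric (over `ℂ`). [folklore] -/
theorem trace_mul_eq_zero_of_transpose {J M : Matrix n n ℂ} (hJ : Jᵀ = -J) (hM : Mᵀ = M) :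
    (J * M).trace = 0 := by
  have h : (J * M).trace = -(J * M).trace := by
    calc (J * M).trace = ((J * M)ᵀ).trace := (trace_transpose _).symm
      _ = (Mᵀ * Jᵀ).trace := by rw [transpose_mul]
      _ = (M * (-J)).trace := by rw [hM, hJ]
      _ = -(J * M).trace := by rw [Matrix.mul_neg, trace_neg, trace_mul_comm]
  have h2 : (2 : ℂ) * (J * M).trace = 0 := by linear_combination h
  exact (mul_eq_zero.1 h2).resolve_left two_ne_zero

/-- A matrix commuting with a symmetric matrix keeps the product symmetric: `(P M)ᵀ = P M` for `Pᵀ = P`, `Mᵀ = M`, `P M = M P`.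
[folklore] -/
theorem transpose_mul_of_commute {P M : Matrix n n ℂ} (hP : Pᵀ = P) (hM : Mᵀ = M) (h : Commute P M) :
    (P * M)ᵀ = P * M := by
  rw [transpose_mul, hP, hM, ← h.eq]

variable {Λ : Type*} [LinearOrder Λ] [Fintype Λ] (G : SimpleGraph Λ) [DecidableRel G.Adj]

/-- `(c†_p c_q)ᵀ = c†_q c_p` (real Jordan–Wigner matrices). [folklore] -/
theorem transpose_creation_mul_annihilation' (p q : Orb Λ) :
    (creation p * annihilation q : Matrix (Finset (Orb Λ)) (Finset (Orb Λ)) ℂ)ᵀ = creation q * annihilation p := by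
  rw [transpose_mul, annihilation_transpose, creation_transpose]

/-- `n_{xσ}` is a symmetric matrix. [folklore] -/
theorem transpose_numberOp (x : Λ) (σ : Fin 2) :
    (numberOp x σ : Matrix (Finset (Orb Λ)) (Finset (Orb Λ)) ℂ)ᵀ = numberOp x σ :=
  transpose_creation_mul_annihilation' _ _

omit [DecidableRel G.Adj] in
/-- **Every local Hubbard term is a (real) symmetric matrix** in the occupation basis: the symmetrised hopping
`−(t/2) Σ_σ (c†_{xσ}c_{yσ} + c†_{yσ}c_{xσ})` and the diagonal on-site term. [folklore] -/
theorem transpose_hubbardTermOp (t U μ : ℝ) (Z : HubbardIdx G) :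
    (hubbardTermOp G t U μ Z)ᵀ = hubbardTermOp G t U μ Z := by
  cases Z with
  | inl p =>
    unfold hubbardTermOp
    rw [transpose_smul, transpose_sum]
    congr 1
    refine Finset.sum_congr rfl fun σ _ => ?_
    rw [transpose_add, transpose_creation_mul_annihilation', transpose_creation_mul_annihilation', add_comm]
  | inr x =>
    unfold hubbardTermOp
    have hc : (numberOp x 1 : Matrix (Finset (Orb Λ)) (Finset (Orb Λ)) ℂ) * numberOp x 0 = numberOp x 0 * numberOp x 1 :=
      (numberAt_commute (orb x 1) (orb x 0)).eq
    rw [transpose_sub, transpose_smul, transpose_smul, transpose_mul, transpose_add, transpose_numberOp, transpose_numberOp, hc]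

omit [DecidableRel G.Adj] in
/-- Partial sums of local Hubbard terms are symmetric matrices. [folklore] -/
theorem transpose_sum_hubbardTermOp (t U μ : ℝ) (T : Finset (HubbardIdx G)) :
    (∑ Z ∈ T, hubbardTermOp G t U μ Z)ᵀ = ∑ Z ∈ T, hubbardTermOp G t U μ Z := by
  rw [transpose_sum]
  exact Finset.sum_congr rfl fun Z _ => transpose_hubbardTermOp G t U μ Z

omit [DecidableRel G.Adj] in
/-- **Partial Boltzmann factors are symmetric**: `(exp(c · Σ_{Z ∈ T} h_Z))ᵀ = exp(c · Σ_{Z ∈ T} h_Z)` for every complex `c`. [folklore] -/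
theorem transpose_exp_smul_sum_hubbardTermOp (c : ℂ) (t U μ : ℝ) (T : Finset (HubbardIdx G)) :
    (NormedSpace.exp (c • ∑ Z ∈ T, hubbardTermOp G t U μ Z))ᵀ = NormedSpace.exp (c • ∑ Z ∈ T, hubbardTermOp G t U μ Z) := by
  rw [← Matrix.exp_transpose, transpose_smul, transpose_sum_hubbardTermOp]

/-- **The plain bond current is an antisymmetric matrix**: `jᵀ = −j` for
`j = Σ_σ (−i c†_{aσ}c_{bσ} + i c†_{bσ}c_{aσ})` (`i ×` a real antisymmetric matrix). [folklore] -/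
theorem transpose_current (a b : Λ) :
    (∑ σ : Fin 2, ((-Complex.I) • (creation (orb a σ) * annihilation (orb b σ)) +
        Complex.I • (creation (orb b σ) * annihilation (orb a σ))) : Matrix (Finset (Orb Λ)) (Finset (Orb Λ)) ℂ)ᵀ =
      -(∑ σ : Fin 2, ((-Complex.I) • (creation (orb a σ) * annihilation (orb b σ)) +
        Complex.I • (creation (orb b σ) * annihilation (orb a σ)))) := by
  rw [transpose_sum, ← Finset.sum_neg_distrib]
  refine Finset.sum_congr rfl fun σ _ => ?_
  rw [transpose_add, transpose_smul, transpose_smul, transpose_creation_mul_annihilation',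
    transpose_creation_mul_annihilation', neg_add, ← neg_smul, ← neg_smul, neg_neg, add_comm]

end Transpose

/-! ## §2 Diagonal matrices depending only on the occupations inside `T` are even local operators of `T` -/

section Diagonal

variable {ι : Type*} [LinearOrder ι] [Fintype ι]

/-- **Locality of diagonal matrices**: if `f s` only depends on `s ∩ T`, then `diag f ∈ carEvenSubalgebra T`
(induction on `T`: `diag f = diag g₀ (1 − n_i) + diag g₁ n_i` with `g₀, g₁` local in `T ∖ {i}`). [folklore] -/
theorem diagonal_mem_carEvenSubalgebra_of_inter (T : Finset ι) :
    ∀ f : Finset ι → ℂ, (∀ s, f s = f (s ∩ T)) → diagonal f ∈ carEvenSubalgebra T := by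
  classical
  induction T using Finset.induction_on with
  | empty =>
    intro f hf
    have h : diagonal f = f ∅ • (1 : Matrix (Finset ι) (Finset ι) ℂ) := by
      ext s t
      rw [diagonal_apply, Matrix.smul_apply, Matrix.one_apply, smul_eq_mul]
      by_cases hst : s = t
      · subst hst
        rw [if_pos rfl, if_pos rfl, mul_one, hf s, Finset.inter_empty]
      · rw [if_neg hst, if_neg hst, mul_zero]
    rw [h]
    exact Subalgebra.smul_mem _ (Subalgebra.one_mem _) _
  | @insert i T hi ih =>
    intro f hf
    have hn : (numberAt i : Matrix (Finset ι) (Finset ι) ℂ) = diagonal (fun s : Finset ι => if i ∈ s then (1 : ℂ) else 0) :=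
      numberAt_eq_diagonal i
    have h1 : (1 : Matrix (Finset ι) (Finset ι) ℂ) - numberAt i = diagonal (fun s : Finset ι => if i ∈ s then (0 : ℂ) else 1) := by
      rw [hn, ← diagonal_one]
      ext s t
      rw [Matrix.sub_apply, diagonal_apply, diagonal_apply, diagonal_apply]
      by_cases hst : s = t
      · subst hst
        simp only [if_true]
        split_ifs <;> norm_num
      · simp [hst]
    have key : diagonal f = diagonal (fun s => f (s ∩ T)) * (1 - numberAt i) +
        diagonal (fun s => f (insert i (s ∩ T))) * numberAt i := by
      rw [h1, hn, diagonal_mul_diagonal, diagonal_mul_diagonal, diagonal_add]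
      congr 1
      funext s
      by_cases his : i ∈ s
      · rw [if_pos his, if_pos his, mul_zero, mul_one, zero_add, hf s, Finset.inter_insert_of_mem his]
      · rw [if_neg his, if_neg his, mul_one, mul_zero, add_zero, hf s, Finset.inter_insert_of_notMem his]
    rw [key]
    have hT : carEvenSubalgebra T ≤ carEvenSubalgebra (insert i T) := carEvenSubalgebra_mono (Finset.subset_insert i T)
    have hni : (numberAt i : Matrix (Finset ι) (Finset ι) ℂ) ∈ carEvenSubalgebra (insert i T) :=
      creation_mul_annihilation_mem_carEvenSubalgebra (Finset.mem_insert_self i T) (Finset.mem_insert_self i T)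
    have h0 : diagonal (fun s => f (s ∩ T)) ∈ carEvenSubalgebra T :=
      ih _ fun s => by simp only [Finset.inter_assoc, Finset.inter_self]
    have h1' : diagonal (fun s => f (insert i (s ∩ T))) ∈ carEvenSubalgebra T :=
      ih _ fun s => by simp only [Finset.inter_assoc, Finset.inter_self]
    exact Subalgebra.add_mem _ (Subalgebra.mul_mem _ (hT h0) (Subalgebra.sub_mem _ (Subalgebra.one_mem _) hni))
      (Subalgebra.mul_mem _ (hT h1') hni)

end Diagonal

/-! ## §3 Regional particle numbers and regional sector projections -/

section Regional

variable {Λ : Type*} [LinearOrder Λ] [Fintype Λ]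

/-- `upPart` only sees the up orbitals: `upPart (s ∩ orbSet S) ∩ S = upPart s ∩ S`. [folklore] -/
theorem upPart_inter_orbSet_inter (s : Finset (Orb Λ)) (S : Finset Λ) :
    upPart (s ∩ orbSet S) ∩ S = upPart s ∩ S := by
  ext x
  simp only [Finset.mem_inter, mem_upPart, mem_orbSet]
  constructor
  · rintro ⟨⟨h1, -⟩, h2⟩; exact ⟨h1, h2⟩
  · rintro ⟨h1, h2⟩; exact ⟨⟨h1, h2⟩, h2⟩

/-- `downPart (s ∩ orbSet S) ∩ S = downPart s ∩ S`. [folklore] -/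
theorem downPart_inter_orbSet_inter (s : Finset (Orb Λ)) (S : Finset Λ) :
    downPart (s ∩ orbSet S) ∩ S = downPart s ∩ S := by
  ext x
  simp only [Finset.mem_inter, mem_downPart, mem_orbSet]
  constructor
  · rintro ⟨⟨h1, -⟩, h2⟩; exact ⟨h1, h2⟩
  · rintro ⟨h1, h2⟩; exact ⟨⟨h1, h2⟩, h2⟩

/-- **Regional diagonal functions are even local operators**: every diagonal matrix whose entry at `s` only depends on
`(upPart s ∩ S, downPart s ∩ S)` lies in `carEvenSubalgebra (orbSet S)`. [folklore] -/
theorem diagonal_regional_mem (S : Finset Λ) (g : Finset Λ → Finset Λ → ℂ) :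
    diagonal (fun s : Finset (Orb Λ) => g (upPart s ∩ S) (downPart s ∩ S)) ∈ carEvenSubalgebra (orbSet S) := by
  refine diagonal_mem_carEvenSubalgebra_of_inter (orbSet S) _ fun s => ?_
  simp only [upPart_inter_orbSet_inter, downPart_inter_orbSet_inter]

/-- A matrix commuting with a diagonal matrix has entries only between equal diagonal values. [folklore] -/
theorem apply_eq_of_commute_diagonal {m : Type*} [Fintype m] [DecidableEq m] {M : Matrix m m ℂ} {g : m → ℂ}
    (h : Commute M (diagonal g)) {s t : m} (hst : M s t ≠ 0) : g s = g t := by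
  have h1 := congrFun (congrFun h.eq s) t
  rw [mul_diagonal, diagonal_mul] at h1
  -- `M s t * g t = g s * M s t`
  have h2 : M s t * (g t - g s) = 0 := by rw [mul_sub, h1]; ring
  rcases mul_eq_zero.1 h2 with h3 | h3
  · exact absurd h3 hst
  · exact (sub_eq_zero.1 h3).symm

/-- Conversely, a matrix with entries only between equal values of `g` commutes with `diag g`. [folklore] -/
theorem commute_diagonal_of_apply {m : Type*} [Fintype m] [DecidableEq m] {M : Matrix m m ℂ} {g : m → ℂ}
    (h : ∀ s t, M s t ≠ 0 → g s = g t) : Commute M (diagonal g) := by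
  rw [Commute, SemiconjBy]
  ext s t
  rw [mul_diagonal, diagonal_mul]
  by_cases hst : M s t = 0
  · rw [hst, mul_zero, zero_mul]
  · rw [h s t hst, mul_comm]

/-- The number of up particles OUTSIDE `S` is an even local operator of `Sᶜ`:
`diag(#(upPart s ∖ S), #(downPart s ∖ S))`-functions lie in `carEvenSubalgebra (orbSet Sᶜ)`. [folklore] -/
theorem diagonal_coregional_mem (S : Finset Λ) (g : Finset Λ → Finset Λ → ℂ) :
    diagonal (fun s : Finset (Orb Λ) => g (upPart s \ S) (downPart s \ S)) ∈ carEvenSubalgebra (orbSet Sᶜ) := by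
  have h : (fun s : Finset (Orb Λ) => g (upPart s \ S) (downPart s \ S)) =
      fun s => g (upPart s ∩ Sᶜ) (downPart s ∩ Sᶜ) := by
    funext s
    rw [Finset.sdiff_eq_inter_compl, Finset.sdiff_eq_inter_compl]
  rw [h]
  exact diagonal_regional_mem Sᶜ g

/-- **Regional particle-number conservation.** An even local operator of the sites `S` that conserves `(N↑, N↓)` has matrix
elements only between configurations with the same numbers of up and of down particles INSIDE `S`. [folklore] -/
theorem regional_card_eq_of_apply_ne_zero {S : Finset Λ} {A : Matrix (Finset (Orb Λ)) (Finset (Orb Λ)) ℂ}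
    (hA : A ∈ carEvenSubalgebra (orbSet S)) (hP : PreservesSectors A) {s t : Finset (Orb Λ)} (hst : A s t ≠ 0) :
    (upPart s ∩ S).card = (upPart t ∩ S).card ∧ (downPart s ∩ S).card = (downPart t ∩ S).card := by
  -- `A` commutes with the particle numbers outside `S` (disjoint even locality)
  have hcu : Commute A (diagonal fun s : Finset (Orb Λ) => ((upPart s \ S).card : ℂ)) :=
    commute_of_mem_carEvenSubalgebra hA
      (carEvenSubalgebra_le_carSubalgebra _ (diagonal_coregional_mem S fun u _ => (u.card : ℂ)))
      (disjoint_orbSet (by simpa using disjoint_compl_right))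
  have hcd : Commute A (diagonal fun s : Finset (Orb Λ) => ((downPart s \ S).card : ℂ)) :=
    commute_of_mem_carEvenSubalgebra hA
      (carEvenSubalgebra_le_carSubalgebra _ (diagonal_coregional_mem S fun _ v => (v.card : ℂ)))
      (disjoint_orbSet (by simpa using disjoint_compl_right))
  have hu := apply_eq_of_commute_diagonal hcu hst
  have hd := apply_eq_of_commute_diagonal hcd hst
  have hu' : (upPart s \ S).card = (upPart t \ S).card := by exact_mod_cast hu
  have hd' : (downPart s \ S).card = (downPart t \ S).card := by exact_mod_cast hd
  obtain ⟨h1, h2⟩ := hP s t hst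
  have e1 := Finset.card_inter_add_card_sdiff (upPart s) S
  have e2 := Finset.card_inter_add_card_sdiff (upPart t) S
  have e3 := Finset.card_inter_add_card_sdiff (downPart s) S
  have e4 := Finset.card_inter_add_card_sdiff (downPart t) S
  constructor <;> omega

/-- **Commutation with the regional sector functions**: an even local operator of `S` conserving `(N↑, N↓)` commutes with every
diagonal function of `(N↑_S, N↓_S)`. [folklore] -/
theorem commute_diagonal_regional {S : Finset Λ} {A : Matrix (Finset (Orb Λ)) (Finset (Orb Λ)) ℂ}
    (hA : A ∈ carEvenSubalgebra (orbSet S)) (hP : PreservesSectors A) (g : ℕ → ℕ → ℂ) :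
    Commute A (diagonal fun s : Finset (Orb Λ) => g (upPart s ∩ S).card (downPart s ∩ S).card) :=
  commute_diagonal_of_apply fun s t hst => by
    obtain ⟨h1, h2⟩ := regional_card_eq_of_apply_ne_zero hA hP hst
    rw [h1, h2]

/-- The regional sector functions are even local operators of `S`. [folklore] -/
theorem diagonal_regional_card_mem (S : Finset Λ) (g : ℕ → ℕ → ℂ) :
    diagonal (fun s : Finset (Orb Λ) => g (upPart s ∩ S).card (downPart s ∩ S).card) ∈ carEvenSubalgebra (orbSet S) :=
  diagonal_regional_mem S fun u v => g u.card v.card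

/-- The co-regional sector functions are even local operators of `Sᶜ`. [folklore] -/
theorem diagonal_coregional_card_mem (S : Finset Λ) (g : ℕ → ℕ → ℂ) :
    diagonal (fun s : Finset (Orb Λ) => g (upPart s \ S).card (downPart s \ S).card) ∈ carEvenSubalgebra (orbSet Sᶜ) :=
  diagonal_coregional_mem S fun u v => g u.card v.card

/-- **Resolution of the identity by the regional sectors**: `Σ_{u,v ≤ |S|} P^S_{u,v} = 1`. [folklore] -/
theorem sum_sum_diagonal_regional_eq_one (S : Finset Λ) :
    ∑ u ∈ Finset.range (S.card + 1), ∑ v ∈ Finset.range (S.card + 1),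
      diagonal (fun s : Finset (Orb Λ) => if (upPart s ∩ S).card = u ∧ (downPart s ∩ S).card = v then (1 : ℂ) else 0) = 1 := by
  rw [← diagonal_one]
  have h : ∀ s : Finset (Orb Λ), (∑ u ∈ Finset.range (S.card + 1), ∑ v ∈ Finset.range (S.card + 1),
      (if (upPart s ∩ S).card = u ∧ (downPart s ∩ S).card = v then (1 : ℂ) else 0)) = 1 := by
    intro s
    have hu : (upPart s ∩ S).card ∈ Finset.range (S.card + 1) :=
      Finset.mem_range.2 (Nat.lt_succ_of_le (Finset.card_le_card Finset.inter_subset_right))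
    have hv : (downPart s ∩ S).card ∈ Finset.range (S.card + 1) :=
      Finset.mem_range.2 (Nat.lt_succ_of_le (Finset.card_le_card Finset.inter_subset_right))
    rw [Finset.sum_eq_single_of_mem _ hu, Finset.sum_eq_single_of_mem _ hv, if_pos ⟨rfl, rfl⟩]
    · intro v _ hv'
      rw [if_neg (fun h => hv' h.2.symm)]
    · intro u _ hu'
      exact Finset.sum_eq_zero fun v _ => if_neg (fun h => hu' h.1.symm)
  ext s t
  simp only [Matrix.sum_apply, diagonal_apply]
  by_cases hst : s = t
  · subst hst
    simp only [if_true]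
    exact h s
  · simp [hst]

/-- **The global sector seen from a region**: on the regional sector `(u, v)` of `S`, the global sector projection `P_{M,N}` is
the CO-regional diagonal `[u + #(↑ outside S) = M ∧ v + #(↓ outside S) = N]`. [folklore] -/
theorem spinSectorProj_mul_diagonal_regional (S : Finset Λ) (M N u v : ℕ) :
    spinSectorProj M N *
        diagonal (fun s : Finset (Orb Λ) => if (upPart s ∩ S).card = u ∧ (downPart s ∩ S).card = v then (1 : ℂ) else 0) =
      diagonal (fun s : Finset (Orb Λ) =>
          if u + (upPart s \ S).card = M ∧ v + (downPart s \ S).card = N then (1 : ℂ) else 0) *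
        diagonal (fun s : Finset (Orb Λ) => if (upPart s ∩ S).card = u ∧ (downPart s ∩ S).card = v then (1 : ℂ) else 0) := by
  rw [spinSectorProj, diagonal_mul_diagonal, diagonal_mul_diagonal]
  congr 1
  funext s
  by_cases h : (upPart s ∩ S).card = u ∧ (downPart s ∩ S).card = v
  · rw [if_pos h, mul_one, mul_one]
    have e1 := Finset.card_inter_add_card_sdiff (upPart s) S
    have e2 := Finset.card_inter_add_card_sdiff (downPart s) S
    obtain ⟨hu, hv⟩ := h
    by_cases h' : (upPart s).card = M ∧ (downPart s).card = N
    · rw [if_pos h', if_pos (by omega)]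
    · rw [if_neg h', if_neg (by omega)]
  · rw [if_neg h, mul_zero, mul_zero]

end Regional

end Summit.Ventures.CertifiedManyBodySolver.Theorems.TcThermcert1.HighTempCurrentClustering

end
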